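import Literature.AnabelianGeometry.SemiGraphs.InducedAlongSquare
import Literature.AnabelianGeometry.SemiGraphs.InducedAlongInheritance
import Literature.AnabelianGeometry.SemiGraphs.Commensurability
import Literature.AnabelianGeometry.SemiGraphs.StarSubSemiGraph

/-!
# Approximators restrict to pull-backs; sub-semi-graphs of anabelioids of a quasi-coherent `𝒢` are quasi-coherent ([SemiAnbd] Def 2.3)

Mochizuki, *Semi-graphs of anabelioids*, Publ. RIMS **42** (2006), §2 Def 2.3 (ii) p.24–25 (an
*approximator* `𝒢 → 𝒢′`: an isomorphism on underlying semi-graphs onto a semi-graph of anabelioids of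
bounded order; *`π₁`-epimorphic* approximators), Def 2.3 (iii) p.25 (*quasi-coherent*: every collection
of finite étale coverings `ℋ_c → 𝒢_c` of degree `≤ M` is split by some approximator), Def 2.1 p.24 (the
restriction `𝒢_ℍ` to a sub-semi-graph `ℍ ⊆ 𝔾`), §4 p.51 (finite open objects of `Loc(𝔾, Γ)` are
quasi-coherent) (kurims `paper:url-f33ace170ff4`). [cite: MochizukiSemiAnbd2006, Def. 2.3(iii) p.25]

PROOF-ONLY (cell abc-iut, layer L3, seat abc-iut-L3-t12 gen 10; brick B3a «APPROXIMATOR RESTRICTION TO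
PULL-BACKS» of the L3 lead's row «PROP47@REAL-CONSTRUCTION» (γ), SHAPES memo
`HOME/staging/L3/L3-t12/g10/SHAPES-gamma-LinkInCovering.md`; no definition — the restricted approximator
is abc-iut-L3-t3's `HomOver.inducedAlongSquare φ ι₁ ι₂ κ r` (`InducedAlongSquare.lean`) named inside the
statements).  Rmk 2.4.1-type heredity which print uses silently ("immediate from the definitions"):

* `HomOver.isApproximator_inducedAlongSquare` / `isPi1EpiApproximator_inducedAlongSquare` — an
  approximator (resp. `π₁`-epimorphic approximator) `φ : 𝒢 → 𝒢′` over `f` RESTRICTS, along any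
  commutative square `ι₁ ≫ f = κ ≫ ι₂` with `κ` an isomorphism, to an approximator
  `𝒢_{H₁} → 𝒢′_{H₂}` of the pull-backs (bounded order of the target: `inducedAlong_isOfInjectiveType` and
  the same finite vertex groups; `π₁`-epimorphy through the transported identities `idV`/`idE`);
* ★ `IsQuasiCoherent.inducedAlong_subgraph` — **the restriction `𝒢_ℍ` of a QUASI-COHERENT `𝒢` to any
  sub-semi-graph `ℍ ⊆ 𝔾` is quasi-coherent**: a collection of coverings of the constituents of `𝒢_ℍ` is
  extended to `𝒢` by the trivial covering off `ℍ` (any basepoint, `GaloisCategory.getFiberFunctor`),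
  split by an approximator of `𝒢` (Def 2.3 (iii)), which is then restricted along `ℍ ↪ 𝔾`;
* ★ `IsElevated.inducedAlong` / `IsTotallyElevated.inducedAlong` (brick B3b) — **elevated vertices
  stay elevated in ANY pull-back `𝒢_H`** (Def 2.4 (i): same vertex group, branches at `w` map to branches
  at `ι w`, the `N`-subgroup clause read through the transported edge identities of the pull-back,
  `π₁`-epimorphic approximators restricted as above);
* `SgAQuot.SgA.starAt_isQuasiCoherent` / `starAt_isTotallyElevated` — in particular the full stars `X.starAt S` of brick B1
  (`StarSubSemiGraph.lean`), i.e. the carrier of "the link contained in `𝔾₃` determined by `v₃, e₃`"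
  (Prop 4.7 proof p.57), are quasi-coherent, resp. totally elevated, when `X` is — the clauses
  `isQuasiCoherent` / `isTotallyElevated` of the finite-open datum of the star-link (memo §4).

Honest scope: sub-semi-graphs only (inclusions `Subgraph.ι`, so that no transport of basepoints along
an injection is needed; pull-backs along arbitrary injective immersions are isomorphic to such);
nothing printed is discharged by itself (a heredity brick); typed ≠ proved; nothing here takes a side on
[IUTchIII] Cor. 3.12.
-/

noncomputable section

namespace Literature.AnabelianGeometry.SemiGraphs

open CategoryTheory CategoryTheory.PreGaloisCategory Literature.AnabelianGeometry.Anabelioids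
open scoped Pointwise

universe v₁ u₁ u

namespace SemiGraphOfAnabelioids

variable {𝒢 ℋ : SemiGraphOfAnabelioids.{v₁, u₁, u}} {f : 𝒢.graph ⟶ ℋ.graph}
  {H₁ H₂ : SemiGraph.{u}}

/-! ### 1. Transported identities do not change `π₁`-epimorphy or kernels -/

/-- `π₁`-epimorphy is unchanged by post-composing with a transported vertex identity.
[cite: MochizukiSemiAnbd2006, Def. 2.3(ii) p.25] -/
theorem isPi1Epi_comp_idV {A : Type u₁} [Category.{v₁} A] [GaloisCategory A] (v v' : ℋ.graph.Vertex)
    (h : v = v') (P : Anabelioids.Hom A (ℋ.V v)) (hP : IsPi1Epi P.pullback) :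
    IsPi1Epi (P.comp (ℋ.idV v v' h)).pullback := by
  subst h; exact hP

/-- `π₁`-epimorphy of an edge component at ANY presentation of the image edge.
[cite: MochizukiSemiAnbd2006, Def. 2.3(ii) p.25] -/
theorem isPi1Epi_φE (φ : HomOver 𝒢 ℋ f) (e : 𝒢.graph.Edge) (e₁ : ℋ.graph.Edge) (h₁ : f.edgeMap e = e₁)
    (h : IsPi1Epi (φ.φE e (f.edgeMap e) rfl).pullback) : IsPi1Epi (φ.φE e e₁ h₁).pullback := by
  subst h₁; exact h

/-- The kernel of `π₁` is unchanged by post-composing with a transported vertex identity.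
[cite: MochizukiSemiAnbd2006, Def. 2.3(iii) p.25] -/
theorem ker_pi1Map_comp_idV {A : Type u₁} [Category.{v₁} A] [GaloisCategory A] (v v' : ℋ.graph.Vertex)
    (h : v = v') (P : Anabelioids.Hom A (ℋ.V v)) (F : A ⥤ FintypeCat.{v₁}) [FiberFunctor F] :
    (pi1Map (P.comp (ℋ.idV v v' h)).pullback F).ker = (pi1Map P.pullback F).ker := by
  subst h; rfl

/-- The kernel of `π₁` of an edge component at ANY presentation of the image edge.
[cite: MochizukiSemiAnbd2006, Def. 2.3(iii) p.25] -/
theorem ker_pi1Map_φE (φ : HomOver 𝒢 ℋ f) (e : 𝒢.graph.Edge) (e₁ : ℋ.graph.Edge) (h₁ : f.edgeMap e = e₁)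
    (F : 𝒢.E e ⥤ FintypeCat.{v₁}) [FiberFunctor F] :
    (pi1Map (φ.φE e e₁ h₁).pullback F).ker = (pi1Map (φ.φE e (f.edgeMap e) rfl).pullback F).ker := by
  subst h₁; rfl

/-! ### 2. Approximators restrict along pull-back squares -/

/-- A pull-back `𝒢′_{H}` of a semi-graph of anabelioids of bounded order is of bounded order (same
vertex groups; injective type by `inducedAlong_isOfInjectiveType`). [cite: MochizukiSemiAnbd2006, Def. 2.3(i) p.24] -/
theorem IsOfBoundedOrder.inducedAlong (hℋ : ℋ.IsOfBoundedOrder) (ι : H₂ ⟶ ℋ.graph) :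
    (ℋ.inducedAlong ι).IsOfBoundedOrder := by
  obtain ⟨M, hM, h⟩ := hℋ.exists_bound
  exact ⟨ℋ.inducedAlong_isOfInjectiveType ι hℋ.isOfInjectiveType, M, hM,
    fun w F _ => h (ι.vertexMap w) F⟩

/-- **An approximator restricts along a pull-back square**: if `φ : 𝒢 → 𝒢′` over `f` is an approximator
(Def 2.3 (ii)) and `ι₁ ≫ f = κ ≫ ι₂` with `κ` an isomorphism of semi-graphs, the induced
`𝒢_{H₁} → 𝒢′_{H₂}` over `κ` is an approximator. [cite: MochizukiSemiAnbd2006, Def. 2.3(ii) p.24] -/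
theorem HomOver.isApproximator_inducedAlongSquare (φ : HomOver 𝒢 ℋ f) (hφ : φ.toHom.IsApproximator)
    (ι₁ : H₁ ⟶ 𝒢.graph) (ι₂ : H₂ ⟶ ℋ.graph) (κ : H₁ ⟶ H₂) [IsIso κ] (r : ι₁ ≫ f = κ ≫ ι₂) :
    (φ.inducedAlongSquare ι₁ ι₂ κ r).toHom.IsApproximator :=
  ⟨(inferInstance : IsIso κ), hφ.isOfBoundedOrder.inducedAlong ι₂⟩

/-- **A `π₁`-epimorphic approximator restricts along a pull-back square** to a `π₁`-epimorphic
approximator (its constituents are those of `φ` composed with transported identities).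
[cite: MochizukiSemiAnbd2006, Def. 2.3(ii) p.25] -/
theorem HomOver.isPi1EpiApproximator_inducedAlongSquare (φ : HomOver 𝒢 ℋ f)
    (hφ : φ.toHom.IsPi1EpiApproximator) (ι₁ : H₁ ⟶ 𝒢.graph) (ι₂ : H₂ ⟶ ℋ.graph) (κ : H₁ ⟶ H₂)
    [IsIso κ] (r : ι₁ ≫ f = κ ≫ ι₂) :
    (φ.inducedAlongSquare ι₁ ι₂ κ r).toHom.IsPi1EpiApproximator := by
  refine ⟨φ.isApproximator_inducedAlongSquare hφ.isApproximator ι₁ ι₂ κ r, fun w => ?_, fun e => ?_⟩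
  · exact isPi1Epi_comp_idV _ _ _ (φ.φV (ι₁.vertexMap w)) (hφ.isPi1Epi_V (ι₁.vertexMap w))
  · exact isPi1Epi_φE φ (ι₁.edgeMap e) _ _ (hφ.isPi1Epi_E (ι₁.edgeMap e))

/-! ### 3. Restrictions to sub-semi-graphs of a quasi-coherent `𝒢` are quasi-coherent -/

variable (𝒢)

/-- **The restriction `𝒢_ℍ` of a quasi-coherent semi-graph of anabelioids to a sub-semi-graph `ℍ ⊆ 𝔾`
(pulled back along the inclusion) is quasi-coherent** (Def 2.3 (iii); the heredity print uses for the
finite open objects of `Loc(𝔾, Γ)`, p.51): extend a collection of coverings of the constituents of `𝒢_ℍ`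
to `𝒢` by trivial coverings off `ℍ`, split it by an approximator `φ : 𝒢 → 𝒢′` of `𝒢`, and restrict
`φ` along the square `ℍ ↪ 𝔾 → 𝔾′ = ℍ = ℍ ↪ 𝔾′`. [cite: MochizukiSemiAnbd2006, Def. 2.3(iii) p.25] -/
theorem IsQuasiCoherent.inducedAlong_subgraph (h𝒢 : 𝒢.IsQuasiCoherent) (K : 𝒢.graph.Subgraph) :
    (𝒢.inducedAlong K.ι).IsQuasiCoherent := by
  classical
  refine ⟨𝒢.inducedAlong_isOfInjectiveType K.ι h𝒢.isOfInjectiveType, fun M hM 𝒞 => ?_⟩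
  -- extend the collection to `𝒢`: the given data on `ℍ`, the trivial covering (any basepoint) off `ℍ`
  let DV : ∀ v : 𝒢.graph.Vertex, Σ' (F : 𝒢.V v ⥤ FintypeCat.{v₁}) (_ : FiberFunctor F),
      {U : Subgroup (Aut F) // IsOpen (U : Set (Aut F)) ∧ U.index ≤ M} := fun v =>
    if hv : v ∈ K.verts then
      ⟨𝒞.FV ⟨v, hv⟩, 𝒞.fiberV ⟨v, hv⟩, 𝒞.UV ⟨v, hv⟩, 𝒞.isOpen_UV ⟨v, hv⟩, 𝒞.index_UV ⟨v, hv⟩⟩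
    else
      ⟨GaloisCategory.getFiberFunctor (𝒢.V v), inferInstance, ⊤, isOpen_univ, by
        rw [Subgroup.index_top]; exact hM⟩
  let DE : ∀ e : 𝒢.graph.Edge, Σ' (F : 𝒢.E e ⥤ FintypeCat.{v₁}) (_ : FiberFunctor F),
      {U : Subgroup (Aut F) // IsOpen (U : Set (Aut F)) ∧ U.index ≤ M} := fun e =>
    if he : e ∈ K.edges then
      ⟨𝒞.FE ⟨e, he⟩, 𝒞.fiberE ⟨e, he⟩, 𝒞.UE ⟨e, he⟩, 𝒞.isOpen_UE ⟨e, he⟩, 𝒞.index_UE ⟨e, he⟩⟩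
    else
      ⟨GaloisCategory.getFiberFunctor (𝒢.E e), inferInstance, ⊤, isOpen_univ, by
        rw [Subgroup.index_top]; exact hM⟩
  have hDV : ∀ w : K.toSemiGraph.Vertex,
      DV (K.ι.vertexMap w) = ⟨𝒞.FV w, 𝒞.fiberV w, 𝒞.UV w, 𝒞.isOpen_UV w, 𝒞.index_UV w⟩ :=
    fun w => dif_pos w.2
  have hDE : ∀ e : K.toSemiGraph.Edge,
      DE (K.ι.edgeMap e) = ⟨𝒞.FE e, 𝒞.fiberE e, 𝒞.UE e, 𝒞.isOpen_UE e, 𝒞.index_UE e⟩ :=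
    fun e => dif_pos e.2
  let 𝒞' : CoveringCollection 𝒢 M :=
    { FV := fun v => (DV v).1
      fiberV := fun v => (DV v).2.1
      FE := fun e => (DE e).1
      fiberE := fun e => (DE e).2.1
      UV := fun v => (DV v).2.2.1
      UE := fun e => (DE e).2.2.1
      isOpen_UV := fun v => (DV v).2.2.2.1
      isOpen_UE := fun e => (DE e).2.2.2.1
      index_UV := fun v => (DV v).2.2.2.2
      index_UE := fun e => (DE e).2.2.2.2 }
  -- split it by an approximator of `𝒢`, and restrict that approximator along `ℍ ↪ 𝔾`
  obtain ⟨𝒢', φ, happ, hsplit⟩ := h𝒢.exists_approximator M hM 𝒞'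
  have r : K.ι ≫ φ.base = 𝟙 K.toSemiGraph ≫ (K.ι ≫ φ.base) := (Category.id_comp _).symm
  refine ⟨𝒢'.inducedAlong (K.ι ≫ φ.base),
    (φ.over.inducedAlongSquare K.ι (K.ι ≫ φ.base) (𝟙 _) r).toHom,
    φ.over.isApproximator_inducedAlongSquare happ K.ι (K.ι ≫ φ.base) (𝟙 _) r, ?_, ?_⟩
  · intro w
    have hw : (pi1Map (φ.φV (K.ι.vertexMap w)).pullback (DV (K.ι.vertexMap w)).1).ker ≤
        (DV (K.ι.vertexMap w)).2.2.1 := hsplit.1 (K.ι.vertexMap w)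
    rw [hDV w] at hw
    haveI : FiberFunctor (𝒞.FV w) := 𝒞.fiberV w
    -- the restricted vertex component is `φ_{v}` followed by a transported identity
    have key := ker_pi1Map_comp_idV (φ.base.vertexMap (K.ι.vertexMap w))
      ((K.ι ≫ φ.base).vertexMap ((𝟙 K.toSemiGraph : K.toSemiGraph ⟶ K.toSemiGraph).vertexMap w))
      (congrArg (fun t : K.toSemiGraph ⟶ 𝒢'.graph => t.vertexMap w) r) (φ.over.φV (K.ι.vertexMap w))
      (𝒞.FV w)
    exact key.trans_le hw
  · intro e
    have he : (pi1Map (φ.φE (K.ι.edgeMap e) (φ.base.edgeMap (K.ι.edgeMap e)) rfl).pullback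
        (DE (K.ι.edgeMap e)).1).ker ≤ (DE (K.ι.edgeMap e)).2.2.1 := hsplit.2 (K.ι.edgeMap e)
    rw [hDE e] at he
    haveI : FiberFunctor (𝒞.FE e) := 𝒞.fiberE e
    -- the restricted edge component is `φ_{e}` at another presentation of its image edge
    have key := ker_pi1Map_φE φ.over (K.ι.edgeMap e)
      ((K.ι ≫ φ.base).edgeMap ((𝟙 K.toSemiGraph : K.toSemiGraph ⟶ K.toSemiGraph).edgeMap e))
      ((congrArg (fun t : K.toSemiGraph ⟶ 𝒢'.graph => t.edgeMap e) r).trans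
        (congrArg (K.ι ≫ φ.base).edgeMap (rfl : (𝟙 K.toSemiGraph : K.toSemiGraph ⟶ _).edgeMap e = _)))
      (𝒞.FE e)
    exact key.trans_le he

/-! ### 4. Elevated vertices stay elevated in pull-backs -/

variable {𝒢}

/-- The `N`-subgroup clause of Def 2.4 (i) read through a transported edge identity: if `N` meets
trivially all conjugates of the branch subgroups `Π_b ⊆ Π_v` (any basepoint `Fe` of `𝒢_{e_b}`, any
`α`), then it meets trivially the ranges computed through `(idE ≫ b^*)` for a basepoint of `𝒢_{e₁}`,
`e₁ = e_b` — the shape of the branch morphisms of a pull-back `𝒢_H`.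
[cite: MochizukiSemiAnbd2006, Def. 2.4(i) p.25] -/
theorem inf_conj_range_idE_comp_pull_eq_bot {v : ℋ.graph.Vertex} (F : ℋ.V v ⥤ FintypeCat.{v₁})
    [FiberFunctor F] (N : Subgroup (Aut F)) (b : ℋ.graph.Branch) (hb : ℋ.graph.abuts b = some v)
    (hN : ∀ (Fe : ℋ.E (ℋ.graph.edgeOf b) ⥤ FintypeCat.{v₁}) [FiberFunctor Fe]
      (α : (ℋ.pull b v hb).pullback ⋙ Fe ≅ F) (g : Aut F),
      N ⊓ (ConjAct.toConjAct g • ℋ.branchSubgroup F b hb Fe α) = ⊥)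
    (e₁ : ℋ.graph.Edge) (q : e₁ = ℋ.graph.edgeOf b) (Fe : ℋ.E e₁ ⥤ FintypeCat.{v₁}) [FiberFunctor Fe]
    (α : ((ℋ.idE e₁ _ q).comp (ℋ.pull b v hb)).pullback ⋙ Fe ≅ F) (g : Aut F) :
    N ⊓ (ConjAct.toConjAct g •
      ((Aut.autMulEquivOfIso α).toMonoidHom.comp
        (pi1Map ((ℋ.idE e₁ _ q).comp (ℋ.pull b v hb)).pullback Fe)).range) = ⊥ := by
  subst q
  exact hN Fe α g

/-- **Elevated vertices stay elevated in pull-backs** (Def 2.4 (i); the heredity print uses for finite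
open objects, p.51 "totally elevated", and Rmk 2.4.1): if `ι w` is an elevated vertex of `𝒢`, then `w`
is an elevated vertex of `𝒢_H` for ANY `ι : H → 𝔾` — the vertex group is the same, the branches at `w`
map to branches at `ι w`, and `π₁`-epimorphic approximators of `𝒢` restrict to `𝒢_H`
(`isPi1EpiApproximator_inducedAlongSquare`). [cite: MochizukiSemiAnbd2006, Def. 2.4(i) p.25] -/
theorem IsElevated.inducedAlong (ι : H₁ ⟶ 𝒢.graph) (w : H₁.Vertex)
    (hw : 𝒢.IsElevated (ι.vertexMap w)) : (𝒢.inducedAlong ι).IsElevated w := by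
  intro M hM
  obtain ⟨𝒢', φ, hφ, hN⟩ := hw M hM
  have r : ι ≫ φ.base = 𝟙 H₁ ≫ (ι ≫ φ.base) := (Category.id_comp _).symm
  refine ⟨𝒢'.inducedAlong (ι ≫ φ.base), (φ.over.inducedAlongSquare ι (ι ≫ φ.base) (𝟙 H₁) r).toHom,
    φ.over.isPi1EpiApproximator_inducedAlongSquare hφ ι (ι ≫ φ.base) (𝟙 H₁) r, ?_⟩
  intro F instF
  -- re-read the basepoint instances at `𝒢′_{φ ι w}` (the constituents of the pull-back ARE those of `𝒢′`)
  haveI instF' : @FiberFunctor (𝒢'.V (φ.base.vertexMap (ι.vertexMap w)))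
      (𝒢'.catV (φ.base.vertexMap (ι.vertexMap w))) inferInstance F := instF
  obtain ⟨N, hfin, hcard, hN'⟩ := @hN F instF'
  refine ⟨N, hfin, hcard, fun c hc Fe instFe α g => ?_⟩
  haveI instFe' : @FiberFunctor (𝒢'.E ((ι ≫ φ.base).edgeMap (H₁.edgeOf c)))
      (𝒢'.catE ((ι ≫ φ.base).edgeMap (H₁.edgeOf c))) inferInstance Fe := instFe
  exact @inf_conj_range_idE_comp_pull_eq_bot 𝒢' (φ.base.vertexMap (ι.vertexMap w)) F instF' N
    ((ι ≫ φ.base).branchMap c) ((ι ≫ φ.base).abuts_branchMap c _ hc)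
    (hN' ((ι ≫ φ.base).branchMap c) ((ι ≫ φ.base).abuts_branchMap c _ hc)) _
    ((ι ≫ φ.base).edgeOf_branchMap c).symm Fe instFe' α g

/-- **Pull-backs of a totally elevated `𝒢` are totally elevated**, along any `ι : H → 𝔾`.
[cite: MochizukiSemiAnbd2006, Def. 2.4(i) p.25] -/
theorem IsTotallyElevated.inducedAlong (h𝒢 : 𝒢.IsTotallyElevated) (ι : H₁ ⟶ 𝒢.graph) :
    (𝒢.inducedAlong ι).IsTotallyElevated :=
  ⟨fun w => IsElevated.inducedAlong ι w (h𝒢.isElevated (ι.vertexMap w))⟩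

end SemiGraphOfAnabelioids

/-! ### 5. Full stars of a quasi-coherent / totally elevated object are quasi-coherent / totally elevated -/

namespace SgAQuot.SgA

/-- **The full star `X.starAt S` (brick B1) of a quasi-coherent object `X` of the ambient category is
quasi-coherent** — the clause `isQuasiCoherent` of the finite-open datum of "the link contained in `𝔾₃`
determined by `v₃, e₃`" (Prop 4.7 proof p.57; finite open objects are quasi-coherent, p.51).
[cite: MochizukiSemiAnbd2006, §4, p. 51] -/
theorem starAt_isQuasiCoherent (X : SgA.{v₁, u₁, u}) (S : Set X.toSgA.graph.Vertex)
    (hX : X.toSgA.IsQuasiCoherent) : (X.starAt S).toSgA.IsQuasiCoherent :=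
  hX.inducedAlong_subgraph X.toSgA (X.toSgA.graph.starSubgraph S)

/-- **The full star `X.starAt S` of a totally elevated object `X` is totally elevated** — the clause
`isTotallyElevated` of the finite-open datum of the star-link (finite open objects are totally elevated,
p.51). [cite: MochizukiSemiAnbd2006, §4, p. 51] -/
theorem starAt_isTotallyElevated (X : SgA.{v₁, u₁, u}) (S : Set X.toSgA.graph.Vertex)
    (hX : X.toSgA.IsTotallyElevated) : (X.starAt S).toSgA.IsTotallyElevated :=
  hX.inducedAlong (X.toSgA.graph.starSubgraph S).ι

end SgAQuot.SgA

end Literature.AnabelianGeometry.SemiGraphs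

end
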